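import Literature.Geometry.Riemannian.PinchingEstimatesTwoSingular
import Literature.Geometry.Riemannian.PinchingEstimatesSingular
import Literature.Geometry.Riemannian.HamiltonLemma62
import HarnessLib

/-!
# Hamilton 1986, Thm. 7.1, inequality (3): the pointwise inputs (Lemmas 6.1, 6.2, 7.2, 7.3)
(topic `Geometry/Riemannian`)

Pointwise algebra for the third group of inequalities of the pinching set of **Hamilton 1986,
Thm. 7.1** (J. Differential Geom. 24, p. 170), `(b₂ + b₃)^{2+δ} ≤ J a₁c₁(a - 2b + c)^δ`, towards
`Literature.Geometry.Riemannian.hamilton_positiveCurvatureOperator_classification_four`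
(`HamiltonPCOClassification.lean`; see `HamiltonPCOPinchingOne.lean` for (1) and the overall plan).
Hamilton, p. 172: "For the third inequality we need to use the terms we threw away in the first":
the proof of (3) (Lemma 7.3, (7.4), p. 172) uses the *exact* differential (in)equalities of
Lemma 6.1 and their logarithmic forms (Lemma 7.2),

* `d/dt log a₁ ≥ 2b₁ + 2a₃ + (a₁ - b₁)²/a₁ + 2(a₃/a₁)(a₂ - a₁)` (from `a₁' ≥ a₁² + b₁² + 2a₂a₃`),
* `d/dt log (b₂ + b₃) ≤ 2b₁ + a₃ + c₃ - [b₂/(b₂ + b₃)]·[(a₃ - a₂) + (c₃ - c₂)]`,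
* `d/dt log (a - 2b + c) ≥ a₁ + 2b₁ + c₁` (Lemma 6.2),

together with **Lemma 7.3**: if `(b₂ + b₃)² ≤ G a₁c₁` and `a₃ ≤ H a₁` and `δ` is small (as printed:
`δ ≤ min(1/4H, 1/√(12GH))`), then the thrown-away terms dominate `2δ(a₃ - a₁)`.

In the tree's variational language (`PinchingEstimates*.lean`: `a₁ = x = wᵀAw` at a minimiser `w`,
`a₃ = Mᴬ = u₃ᵀAu₃` at a maximiser, `a₂ = tr A - x - Mᴬ`; `b₂ + b₃ = Y = μ₁ + μ₂` and `b₁ = |κ|` at a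
diagonal Ky Fan maximiser, `b₂ = min(μ₁, μ₂)`; `b = tr (BT)` at a maximiser `T ∈ O(3)` of the
trace) this file PROVES:

* `kyFanMax_field_eq` — the exact value `Y' = μ₁(α₁ + γ₁) + μ₂(α₂ + γ₂) + 2κ(μ₁ + μ₂)` of the
  derivative of the Ky Fan sum at a diagonal maximiser, and `kyFanMax_upper_gap` — Hamilton's
  bound *with* the gap term: `Y' ≤ (Mᴬ + Mᶜ + 2|κ|)Y - min(μ₁, μ₂)[(2Mᴬ - Pᴬ) + (2Mᶜ - Pᶜ)]`
  (`Pᴬ` any bound for the pair sums of `A`; with `Pᴬ = tr A - a₁` the bracket is `a₃ - a₂`);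
* `rayleighMin_field_ge` — `a₁' ≥ a₁² + |ᵗBw|² + 2a₃a₂` exactly (`a₂ = tr A - a₁ - a₃`), and the
  elementary bounds `a₁ ≤ a₂ ≤ a₃`, `α + α' ≤ tr A - a₁` for orthonormal pairs
  (`trace_sub_min_sub_max_bounds`, `pairSum_le_trace_sub_min`);
* `rayleigh_mul_maxTrace_ge` — at a maximiser `T` of `tr (BT)` the symmetric matrix `BT ≥ 0` has
  all Rayleigh quotients `≥ k` whenever `k² ≤ |Be|²` for all unit `e` (`BT = √(BᵗB)` has least
  eigenvalue `b₁`), whence `lemma62_lower`: `tr A' - 2 tr (B'T) + tr C' ≥ (a₁ + 2k + c₁)(a - 2b + c)`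
  from `lemma62_pointwise` (`HamiltonLemma62.lean`);
* `lemma73` — the scalar Lemma 7.3 in the form used: for `0 < x ≤ a₂ ≤ Mᴬ ≤ Hx`, `0 ≤ k ≤ μ`,
  `0 < Y`, `Y² ≤ GHx²`, `0 < δ ≤ 1`, `8Hδ ≤ 1`, `4GHδ² ≤ 1`:
  `2δ(Mᴬ - x) ≤ (x - k)²/x + 2Mᴬ(a₂ - x)/x + 2(μ/Y)(Mᴬ - a₂)`.

No definitions, no named facts (D-0026); the barrier-functional assembly of (3) is a separate file.

## References

* R. S. Hamilton, *Four-manifolds with positive curvature operator*, J. Differential Geom. 24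
  (1986) 153–179: §6, Lemma 6.1 (pp. 167–168), Lemma 6.2 (pp. 168–170); §7, Lemma 7.2 (p. 171),
  Lemma 7.3 and (7.4) (p. 172). [Hamilton1986]
* R. S. Hamilton, Comm. Anal. Geom. 5 (1997), §2.1, Thm. 1.3 (pp. 7–8) (the Ky Fan maximiser
  machinery reused here). [Hamilton1997]
-/

noncomputable section

open Set Real
open scoped Matrix BigOperators

namespace Literature.Geometry.Riemannian

namespace HamiltonODE

variable {A B C : Matrix (Fin 3) (Fin 3) ℝ}

/-! ### The derivative of the Ky Fan sum at a diagonal maximiser, exactly -/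

section Max

variable {u₁ u₂ v₁ v₂ : Fin 3 → ℝ} (hu₁ : u₁ ⬝ᵥ u₁ = 1) (hu₂ : u₂ ⬝ᵥ u₂ = 1) (hu : u₁ ⬝ᵥ u₂ = 0)
  (hv₁ : v₁ ⬝ᵥ v₁ = 1) (hv₂ : v₂ ⬝ᵥ v₂ = 1) (hv : v₁ ⬝ᵥ v₂ = 0)
  (hmax : ∀ u₁' u₂' v₁' v₂' : Fin 3 → ℝ, u₁' ⬝ᵥ u₁' = 1 → u₂' ⬝ᵥ u₂' = 1 → u₁' ⬝ᵥ u₂' = 0 →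
    v₁' ⬝ᵥ v₁' = 1 → v₂' ⬝ᵥ v₂' = 1 → v₁' ⬝ᵥ v₂' = 0 →
    u₁' ⬝ᵥ (B *ᵥ v₁') + u₂' ⬝ᵥ (B *ᵥ v₂') ≤ u₁ ⬝ᵥ (B *ᵥ v₁) + u₂ ⬝ᵥ (B *ᵥ v₂))
  (hdiag : u₁ ⬝ᵥ (B *ᵥ v₂) = 0)
include hu₁ hu₂ hu hv₁ hv₂ hv hmax hdiag

/-- **`Y' = μ₁(α₁ + γ₁) + μ₂(α₂ + γ₂) + 2κ(μ₁ + μ₂)` at a diagonal maximiser** of the Ky Fan sum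
(`μᵢ = uᵢᵀBvᵢ`, `αᵢ = uᵢᵀAuᵢ`, `γᵢ = vᵢᵀCvᵢ`, `κ = u₀ᵀBv₀`): Hamilton's evaluation of
`AB(yᵢ⁺, yᵢ⁻) + BC(yᵢ⁺, yᵢ⁻) + 2B#(yᵢ⁺, yᵢ⁻)` in Lemma 6.1 ("`B#(y₂⁺, y₂⁻) = 2b₁b₃` and
`B#(y₃⁺, y₃⁻) = 2b₁b₂`"), kept exact. [cite: Hamilton1986, §6, Lemma 6.1 (proof, pp. 167–168)] -/
theorem kyFanMax_field_eq :
    u₁ ⬝ᵥ ((A * B + B * C + (2 : ℝ) • B.sharp) *ᵥ v₁) + u₂ ⬝ᵥ ((A * B + B * C + (2 : ℝ) • B.sharp) *ᵥ v₂) =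
      (u₁ ⬝ᵥ (B *ᵥ v₁)) * (u₁ ⬝ᵥ (A *ᵥ u₁) + v₁ ⬝ᵥ (C *ᵥ v₁)) +
        (u₂ ⬝ᵥ (B *ᵥ v₂)) * (u₂ ⬝ᵥ (A *ᵥ u₂) + v₂ ⬝ᵥ (C *ᵥ v₂)) +
        2 * (((u₁ ⨯₃ u₂) ⬝ᵥ (B *ᵥ (v₁ ⨯₃ v₂))) * (u₁ ⬝ᵥ (B *ᵥ v₁) + u₂ ⬝ᵥ (B *ᵥ v₂))) := by
  have hB1 := kyFanMax_mulVec_fst hu₁ hu₂ hu hv₁ hv₂ hv hmax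
  have hB2 := kyFanMax_mulVec_snd hu₁ hu₂ hu hv₁ hv₂ hv hmax
  rw [hdiag] at hB1 hB2
  have hmaxT := kyFanMax_transpose hmax
  have hT1 := kyFanMax_mulVec_fst (B := Bᵀ) hv₁ hv₂ hv hu₁ hu₂ hu hmaxT
  have hT2 := kyFanMax_mulVec_snd (B := Bᵀ) hv₁ hv₂ hv hu₁ hu₂ hu hmaxT
  have hsymm := kyFanMax_symm hu₁ hu₂ hu hv₁ hv₂ hv hmax
  simp only [Matrix.dotProduct_transpose_mulVec] at hT1 hT2
  rw [hsymm, hdiag] at hT1 hT2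
  simp only [zero_smul, add_zero, zero_add] at hB1 hB2 hT1 hT2
  have hsharp := kyFanMax_sharp_sum hu₁ hu₂ hu hv₁ hv₂ hv hmax
  set μ₁ := u₁ ⬝ᵥ (B *ᵥ v₁) with hμ₁
  set μ₂ := u₂ ⬝ᵥ (B *ᵥ v₂) with hμ₂
  have a1 : u₁ ⬝ᵥ ((A * B) *ᵥ v₁) = μ₁ * (u₁ ⬝ᵥ (A *ᵥ u₁)) := by
    rw [← Matrix.mulVec_mulVec, hB1, Matrix.mulVec_smul, dotProduct_smul, smul_eq_mul]
  have a2 : u₂ ⬝ᵥ ((A * B) *ᵥ v₂) = μ₂ * (u₂ ⬝ᵥ (A *ᵥ u₂)) := by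
    rw [← Matrix.mulVec_mulVec, hB2, Matrix.mulVec_smul, dotProduct_smul, smul_eq_mul]
  have c1 : u₁ ⬝ᵥ ((B * C) *ᵥ v₁) = μ₁ * (v₁ ⬝ᵥ (C *ᵥ v₁)) := by
    rw [← Matrix.mulVec_mulVec, Matrix.dotProduct_mulVec, ← Matrix.mulVec_transpose, hT1, smul_dotProduct,
      smul_eq_mul]
  have c2 : u₂ ⬝ᵥ ((B * C) *ᵥ v₂) = μ₂ * (v₂ ⬝ᵥ (C *ᵥ v₂)) := by
    rw [← Matrix.mulVec_mulVec, Matrix.dotProduct_mulVec, ← Matrix.mulVec_transpose, hT2, smul_dotProduct,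
      smul_eq_mul]
  have s1 : u₁ ⬝ᵥ (((2 : ℝ) • B.sharp) *ᵥ v₁) = 2 * (u₁ ⬝ᵥ (B.sharp *ᵥ v₁)) := by
    rw [Matrix.smul_mulVec, dotProduct_smul, smul_eq_mul]
  have s2 : u₂ ⬝ᵥ (((2 : ℝ) • B.sharp) *ᵥ v₂) = 2 * (u₂ ⬝ᵥ (B.sharp *ᵥ v₂)) := by
    rw [Matrix.smul_mulVec, dotProduct_smul, smul_eq_mul]
  rw [Matrix.add_mulVec, Matrix.add_mulVec, dotProduct_add, dotProduct_add, a1, c1, s1,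
    Matrix.add_mulVec, Matrix.add_mulVec, dotProduct_add, dotProduct_add, a2, c2, s2]
  linear_combination (2 : ℝ) * hsharp

/-- **Lemma 6.1 for `b₂ + b₃`, with the gap term** (Hamilton: "`ά₂b₂ + ά₃b₃ ≤ a₂b₂ + a₃b₃`", i.e.
`≤ a₃(b₂ + b₃) - (a₃ - a₂)b₂`): at a diagonal maximiser, for any bounds `Mᴬ` of the Rayleigh
quotients and `Pᴬ` of the orthonormal pair sums of `A` (and `Mᶜ`, `Pᶜ` for `C`),
`Y' ≤ (Mᴬ + Mᶜ + 2|κ|) Y - min(μ₁, μ₂) · [(2Mᴬ - Pᴬ) + (2Mᶜ - Pᶜ)]`.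
[cite: Hamilton1986, §6, Lemma 6.1 (proof, p. 168); §7, Lemma 7.2 (p. 171)] -/
theorem kyFanMax_upper_gap {MA MC PA PC : ℝ}
    (hMA : ∀ e : Fin 3 → ℝ, e ⬝ᵥ e = 1 → e ⬝ᵥ (A *ᵥ e) ≤ MA)
    (hMC : ∀ e : Fin 3 → ℝ, e ⬝ᵥ e = 1 → e ⬝ᵥ (C *ᵥ e) ≤ MC)
    (hPA : ∀ e e' : Fin 3 → ℝ, e ⬝ᵥ e = 1 → e' ⬝ᵥ e' = 1 → e ⬝ᵥ e' = 0 →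
      e ⬝ᵥ (A *ᵥ e) + e' ⬝ᵥ (A *ᵥ e') ≤ PA)
    (hPC : ∀ e e' : Fin 3 → ℝ, e ⬝ᵥ e = 1 → e' ⬝ᵥ e' = 1 → e ⬝ᵥ e' = 0 →
      e ⬝ᵥ (C *ᵥ e) + e' ⬝ᵥ (C *ᵥ e') ≤ PC) :
    u₁ ⬝ᵥ ((A * B + B * C + (2 : ℝ) • B.sharp) *ᵥ v₁) + u₂ ⬝ᵥ ((A * B + B * C + (2 : ℝ) • B.sharp) *ᵥ v₂)
      ≤ (MA + MC + 2 * |(u₁ ⨯₃ u₂) ⬝ᵥ (B *ᵥ (v₁ ⨯₃ v₂))|) * (u₁ ⬝ᵥ (B *ᵥ v₁) + u₂ ⬝ᵥ (B *ᵥ v₂)) -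
        min (u₁ ⬝ᵥ (B *ᵥ v₁)) (u₂ ⬝ᵥ (B *ᵥ v₂)) * ((2 * MA - PA) + (2 * MC - PC)) := by
  rw [kyFanMax_field_eq hu₁ hu₂ hu hv₁ hv₂ hv hmax hdiag]
  have hd1 := kyFanMax_diag_nonneg_fst hu₁ hu₂ hu hv₁ hv₂ hv hmax
  have hd2 := kyFanMax_diag_nonneg_snd hu₁ hu₂ hu hv₁ hv₂ hv hmax
  set μ₁ := u₁ ⬝ᵥ (B *ᵥ v₁) with hμ₁
  set μ₂ := u₂ ⬝ᵥ (B *ᵥ v₂) with hμ₂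
  set κ := (u₁ ⨯₃ u₂) ⬝ᵥ (B *ᵥ (v₁ ⨯₃ v₂)) with hκ
  have hA1 := hMA u₁ hu₁
  have hA2 := hMA u₂ hu₂
  have hC1 := hMC v₁ hv₁
  have hC2 := hMC v₂ hv₂
  have hA12 := hPA u₁ u₂ hu₁ hu₂ hu
  have hC12 := hPC v₁ v₂ hv₁ hv₂ hv
  have hk : κ * (μ₁ + μ₂) ≤ |κ| * (μ₁ + μ₂) := mul_le_mul_of_nonneg_right (le_abs_self _) (by linarith)
  rcases le_total μ₁ μ₂ with h | h
  · rw [min_eq_left h]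
    have h0 : 0 ≤ μ₂ - μ₁ := sub_nonneg.2 h
    nlinarith [mul_le_mul_of_nonneg_left hA12 hd1, mul_le_mul_of_nonneg_left hA2 h0,
      mul_le_mul_of_nonneg_left hC12 hd1, mul_le_mul_of_nonneg_left hC2 h0]
  · rw [min_eq_right h]
    have h0 : 0 ≤ μ₁ - μ₂ := sub_nonneg.2 h
    have hA21 : u₂ ⬝ᵥ (A *ᵥ u₂) + u₁ ⬝ᵥ (A *ᵥ u₁) ≤ PA := by linarith
    have hC21 : v₂ ⬝ᵥ (C *ᵥ v₂) + v₁ ⬝ᵥ (C *ᵥ v₁) ≤ PC := by linarith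
    nlinarith [mul_le_mul_of_nonneg_left hA21 hd2, mul_le_mul_of_nonneg_left hA1 h0,
      mul_le_mul_of_nonneg_left hC21 hd2, mul_le_mul_of_nonneg_left hC1 h0]

end Max

/-! ### `a₁' ≥ a₁² + |ᵗBw|² + 2a₂a₃` and the elementary eigenvalue bounds -/

/-- **Lemma 6.1 for `a₁`, exactly** (Hamilton: "`A²(x₁, x₁) = a₁²`, `BᵗB(x₁, x₁) ≥ b₁²`,
`A#(x₁, x₁) = a₂a₃`"): for symmetric `A` with `a₁ + a₂ ≥ m > 0`, at a minimising unit `w` and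
with `Mᴬ` the maximum of the Rayleigh quotient,
`wᵀ(A² + BᵗB + 2A#)w ≥ (wᵀAw)² + |ᵗBw|² + 2Mᴬ(tr A - wᵀAw - Mᴬ)` (in the diagonalising basis
`(w, y, y')` the last term is `2(yᵀAy)(y'ᵀAy') ≥ 2Mᴬ(yᵀAy + y'ᵀAy' - Mᴬ)` because both quotients
are at most `Mᴬ`). [cite: Hamilton1986, §6, Lemma 6.1 (p. 167)] -/
theorem rayleighMin_field_ge (hA : A.IsSymm) {m : ℝ} (hm : 0 < m) (h12 : A.TwoSmallestEigenvaluesSumGE m)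
    {w u₃ : Fin 3 → ℝ} (hw : w ⬝ᵥ w = 1) (hu₃ : u₃ ⬝ᵥ u₃ = 1)
    (hmin : ∀ z ∈ unitSet, w ⬝ᵥ (A *ᵥ w) ≤ z ⬝ᵥ (A *ᵥ z))
    (hmax : ∀ z ∈ unitSet, z ⬝ᵥ (A *ᵥ z) ≤ u₃ ⬝ᵥ (A *ᵥ u₃)) :
    (w ⬝ᵥ (A *ᵥ w)) ^ 2 + (Bᵀ *ᵥ w) ⬝ᵥ (Bᵀ *ᵥ w) +
        2 * ((u₃ ⬝ᵥ (A *ᵥ u₃)) * (A.trace - w ⬝ᵥ (A *ᵥ w) - u₃ ⬝ᵥ (A *ᵥ u₃))) ≤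
      w ⬝ᵥ ((A * A + B * Bᵀ + (2 : ℝ) • A.sharp) *ᵥ w) := by
  obtain ⟨y, y', hy, hy', hwy, hwy', hyy', _, _, cyy', -⟩ :=
    exists_diag_basis_of_min hA hm h12 hw hu₃ hmin hmax
  have hw0 : ∀ z : Fin 3 → ℝ, z ⬝ᵥ w = 0 → w ⬝ᵥ (A *ᵥ z) = 0 :=
    fun z hz ↦ cross_eq_zero_of_min hA hw hmin hz
  have hyw : y ⬝ᵥ w = 0 := by rw [dotProduct_comm]; exact hwy
  have hy'w : y' ⬝ᵥ w = 0 := by rw [dotProduct_comm]; exact hwy'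
  have cyw : y ⬝ᵥ (A *ᵥ w) = 0 := by rw [quad_comm_of_isSymm hA]; exact hw0 y hyw
  have cy'w : y' ⬝ᵥ (A *ᵥ w) = 0 := by rw [quad_comm_of_isSymm hA]; exact hw0 y' hy'w
  rw [quad_field_eq_of_diag (N := B) hA hy hy' hw hyy' hyw hy'w cyy' cyw cy'w]
  have htr : y ⬝ᵥ (A *ᵥ y) + y' ⬝ᵥ (A *ᵥ y') + w ⬝ᵥ (A *ᵥ w) = A.trace :=
    sum_quadratic_eq_trace_of_orthonormal A hy hy' hw hyy' hyw hy'w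
  have d1 := hmax y hy
  have d2 := hmax y' hy'
  have htr' : A.trace - w ⬝ᵥ (A *ᵥ w) - u₃ ⬝ᵥ (A *ᵥ u₃) =
      y ⬝ᵥ (A *ᵥ y) + y' ⬝ᵥ (A *ᵥ y') - u₃ ⬝ᵥ (A *ᵥ u₃) := by linarith
  rw [htr']
  nlinarith [mul_nonneg (sub_nonneg.2 d1) (sub_nonneg.2 d2)]

/-- **`a₁ ≤ a₂ ≤ a₃`, variationally**: with `x = wᵀAw` the minimum and `Mᴬ = u₃ᵀAu₃` the maximum of
the Rayleigh quotient over unit vectors, `x ≤ tr A - x - Mᴬ ≤ Mᴬ` (complete `u₃`, resp. `w`, to an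
orthonormal basis and use `tr A = Σ eᵢᵀAeᵢ`). [folklore] -/
theorem trace_sub_min_sub_max_bounds {w u₃ : Fin 3 → ℝ} (hw : w ⬝ᵥ w = 1) (hu₃ : u₃ ⬝ᵥ u₃ = 1)
    (hmin : ∀ z ∈ unitSet, w ⬝ᵥ (A *ᵥ w) ≤ z ⬝ᵥ (A *ᵥ z))
    (hmax : ∀ z ∈ unitSet, z ⬝ᵥ (A *ᵥ z) ≤ u₃ ⬝ᵥ (A *ᵥ u₃)) :
    w ⬝ᵥ (A *ᵥ w) ≤ A.trace - w ⬝ᵥ (A *ᵥ w) - u₃ ⬝ᵥ (A *ᵥ u₃) ∧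
      A.trace - w ⬝ᵥ (A *ᵥ w) - u₃ ⬝ᵥ (A *ᵥ u₃) ≤ u₃ ⬝ᵥ (A *ᵥ u₃) := by
  obtain ⟨g₁, g₂, hg₁, hg₂, hug₁, hug₂, hg₁₂⟩ := exists_orthonormal_complement hu₃
  obtain ⟨f₁, f₂, hf₁, hf₂, hwf₁, hwf₂, hf₁₂⟩ := exists_orthonormal_complement hw
  have htr₁ := sum_quadratic_eq_trace_of_orthonormal A hu₃ hg₁ hg₂ hug₁ hug₂ hg₁₂
  have htr₂ := sum_quadratic_eq_trace_of_orthonormal A hw hf₁ hf₂ hwf₁ hwf₂ hf₁₂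
  have h1 := hmin g₁ hg₁
  have h2 := hmin g₂ hg₂
  have h3 := hmax f₁ hf₁
  have h4 := hmax f₂ hf₂
  constructor <;> linarith

/-- **`α + α' ≤ a₂ + a₃ = tr A - a₁`** for every orthonormal pair: the third vector of the frame
has Rayleigh quotient at least the minimum `x`. [folklore] -/
theorem pairSum_le_trace_sub_min {w : Fin 3 → ℝ}
    (hmin : ∀ z ∈ unitSet, w ⬝ᵥ (A *ᵥ w) ≤ z ⬝ᵥ (A *ᵥ z)) {e e' : Fin 3 → ℝ} (he : e ⬝ᵥ e = 1)
    (he' : e' ⬝ᵥ e' = 1) (hee' : e ⬝ᵥ e' = 0) :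
    e ⬝ᵥ (A *ᵥ e) + e' ⬝ᵥ (A *ᵥ e') ≤ A.trace - w ⬝ᵥ (A *ᵥ w) := by
  have hn : (e ⨯₃ e') ⬝ᵥ (e ⨯₃ e') = 1 := dotProduct_cross_self_of_orthonormal he he' hee'
  have htr := sum_quadratic_eq_trace_of_orthonormal A he he' hn hee' (dot_self_cross e e')
    (dot_cross_self e e')
  have h := hmin (e ⨯₃ e') hn
  linarith

/-- The Rayleigh quotient of any vector is at least the minimum over unit vectors times `|u|²`.
[folklore] -/
theorem min_mul_normSq_le_quad {D : Matrix (Fin 3) (Fin 3) ℝ} {e : Fin 3 → ℝ}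
    (hmin : ∀ z ∈ unitSet, e ⬝ᵥ (D *ᵥ e) ≤ z ⬝ᵥ (D *ᵥ z)) (u : Fin 3 → ℝ) :
    (e ⬝ᵥ (D *ᵥ e)) * (u ⬝ᵥ u) ≤ u ⬝ᵥ (D *ᵥ u) := by
  by_cases hu : u = 0
  · simp [hu]
  have huu : 0 < u ⬝ᵥ u := lt_of_le_of_ne (Finset.sum_nonneg fun i _ ↦ mul_self_nonneg _)
    (fun h ↦ hu (dotProduct_self_eq_zero.1 h.symm))
  set c := (u ⬝ᵥ u)⁻¹.sqrt with hc
  have hcu : (c • u) ⬝ᵥ (c • u) = 1 := normalize_dot_self hu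
  have hc2 : c ^ 2 = (u ⬝ᵥ u)⁻¹ := Real.sq_sqrt (inv_nonneg.2 huu.le)
  have h := hmin (c • u) hcu
  rw [Matrix.mulVec_smul, dotProduct_smul, smul_dotProduct, smul_eq_mul, smul_eq_mul, ← mul_assoc,
    ← sq, hc2] at h
  rwa [le_inv_mul_iff₀ huu, mul_comm] at h

/-! ### `BT` at a maximiser of `tr (BT)`: its least Rayleigh quotient is `b₁` -/

/-- **At a maximiser `T ∈ O(3)` of `tr (BT)`, `ᵗu (BT) u ≥ k |u|²` whenever
`k² ≤ |Be|²` for all unit `e`** (`BT` is symmetric `≥ 0` with `(BT)² ∼ BᵗB`, so its least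
eigenvalue is the least singular value `b₁` of `B`; at a minimiser `e` of the Rayleigh quotient of
`D = BT`, `De = d e` and `d² = |B(Te)|² ≥ k²`). [cite: Hamilton1986, §6, p. 168 ("`B` is diagonal with entries `b₁ ≤ b₂ ≤ b₃`")] -/
theorem rayleigh_mul_maxTrace_ge {T : Matrix (Fin 3) (Fin 3) ℝ}
    (hmax : ∀ T' : Matrix (Fin 3) (Fin 3) ℝ, T'ᵀ * T' = 1 → (B * T').trace ≤ (B * T).trace)
    (hT : Tᵀ * T = 1) {k : ℝ}
    (hkB : ∀ e : Fin 3 → ℝ, e ⬝ᵥ e = 1 → k ^ 2 ≤ (B *ᵥ e) ⬝ᵥ (B *ᵥ e)) (u : Fin 3 → ℝ) :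
    k * (u ⬝ᵥ u) ≤ u ⬝ᵥ ((B * T) *ᵥ u) := by
  set D := B * T with hD
  have hDs : D.IsSymm := isSymm_of_isMaxTrace hmax hT
  have hD0 : ∀ v : Fin 3 → ℝ, 0 ≤ v ⬝ᵥ (D *ᵥ v) := quad_nonneg_of_isMaxTrace hmax hT
  -- a minimiser `e` of the Rayleigh quotient of `D`
  obtain ⟨e, he, hmin⟩ := isCompact_unitSet.exists_isMinOn unitSet_nonempty
    (continuous_rayleigh D).continuousOn
  have he1 : e ⬝ᵥ e = 1 := he
  have hmin' : ∀ z ∈ unitSet, e ⬝ᵥ (D *ᵥ e) ≤ z ⬝ᵥ (D *ᵥ z) := fun z hz ↦ hmin hz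
  set d := e ⬝ᵥ (D *ᵥ e) with hd
  have hd0 : 0 ≤ d := hD0 e
  -- `e` is an eigenvector: `De = d e`
  obtain ⟨f₁, f₂, hf₁, hf₂, hef₁, hef₂, hf₁₂⟩ := exists_orthonormal_complement he1
  have c1 : e ⬝ᵥ (D *ᵥ f₁) = 0 := cross_eq_zero_of_min hDs he1 hmin' (by rw [dotProduct_comm]; exact hef₁)
  have c2 : e ⬝ᵥ (D *ᵥ f₂) = 0 := cross_eq_zero_of_min hDs he1 hmin' (by rw [dotProduct_comm]; exact hef₂)
  have hDe : D *ᵥ e = d • e := by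
    have h := expand_orthonormal he1 hf₁ hf₂ hef₁ hef₂ hf₁₂ (D *ᵥ e)
    rw [quad_comm_of_isSymm hDs f₁ e, quad_comm_of_isSymm hDs f₂ e, c1, c2, zero_smul, zero_smul,
      add_zero, add_zero] at h
    exact h
  -- `|De|² = d²` and `De = B(Te)` with `Te` a unit vector
  have hTe : (T *ᵥ e) ⬝ᵥ (T *ᵥ e) = 1 := by
    rw [← Matrix.dotProduct_transpose_mulVec, Matrix.mulVec_mulVec, hT, Matrix.one_mulVec, he1]
  have hk2 : k ^ 2 ≤ d ^ 2 := by
    have h := hkB (T *ᵥ e) hTe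
    rw [Matrix.mulVec_mulVec, ← hD, hDe, smul_dotProduct, dotProduct_smul, smul_eq_mul, smul_eq_mul,
      he1] at h
    nlinarith
  have hkd : k ≤ d := by nlinarith
  exact (mul_le_mul_of_nonneg_right hkd (Finset.sum_nonneg fun i _ ↦ mul_self_nonneg _)).trans
    (min_mul_normSq_le_quad hmin' u)

/-- **Lemma 6.2 with `p₁ = a₁ + 2b₁ + c₁`, variationally**: for symmetric `A`, `C` with
`tr A = tr C`, `M = (A B; ᵗB C) ≥ 0`, `T ∈ O(3)` maximising `tr (BT)`, `w`, `z` unit minimisers of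
the Rayleigh quotients of `A`, `C`, and `k` with `k² ≤ |Be|²` for all unit `e`:
`(wᵀAw + 2k + zᵀCz)(tr A - 2 tr (BT) + tr C) ≤ tr A' - 2 tr (B'T) + tr C'`.
[cite: Hamilton1986, §6, Lemma 6.2 (pp. 168–170); §7, Lemma 7.2 (p. 171)] -/
theorem lemma62_lower {T : Matrix (Fin 3) (Fin 3) ℝ} (hA : A.IsSymm) (hC : C.IsSymm)
    (htr : A.trace = C.trace) (hM : OperatorGE (A, B, C) 0) (hT : Tᵀ * T = 1)
    (hmax : ∀ T' : Matrix (Fin 3) (Fin 3) ℝ, T'ᵀ * T' = 1 → (B * T').trace ≤ (B * T).trace)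
    {w z : Fin 3 → ℝ} (hminW : ∀ e ∈ unitSet, w ⬝ᵥ (A *ᵥ w) ≤ e ⬝ᵥ (A *ᵥ e))
    (hminZ : ∀ e ∈ unitSet, z ⬝ᵥ (C *ᵥ z) ≤ e ⬝ᵥ (C *ᵥ e)) {k : ℝ}
    (hkB : ∀ e : Fin 3 → ℝ, e ⬝ᵥ e = 1 → k ^ 2 ≤ (B *ᵥ e) ⬝ᵥ (B *ᵥ e)) :
    (w ⬝ᵥ (A *ᵥ w) + 2 * k + z ⬝ᵥ (C *ᵥ z)) * (A.trace - 2 * (B * T).trace + C.trace) ≤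
      (field (A, B, C)).1.trace + (field (A, B, C)).2.2.trace -
        2 * ((field (A, B, C)).2.1 * T).trace := by
  refine lemma62_pointwise hA hC htr hM hT hmax fun u ↦ ?_
  have h1 := min_mul_normSq_le_quad hminW u
  have h2 := rayleigh_mul_maxTrace_ge hmax hT hkB u
  have hTu : (T *ᵥ u) ⬝ᵥ (T *ᵥ u) = u ⬝ᵥ u := by
    rw [← Matrix.dotProduct_transpose_mulVec, Matrix.mulVec_mulVec, hT, Matrix.one_mulVec]
  have h3 := min_mul_normSq_le_quad hminZ (T *ᵥ u)
  rw [hTu] at h3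
  have h' : u ⬝ᵥ ((Tᵀ * C * T) *ᵥ u) = (T *ᵥ u) ⬝ᵥ (C *ᵥ (T *ᵥ u)) := by
    rw [Matrix.mul_assoc, ← Matrix.mulVec_mulVec, Matrix.dotProduct_transpose_mulVec,
      ← Matrix.mulVec_mulVec, dotProduct_comm]
  have e : u ⬝ᵥ ((A + (2 : ℝ) • (B * T) + Tᵀ * C * T) *ᵥ u) =
      u ⬝ᵥ (A *ᵥ u) + 2 * (u ⬝ᵥ ((B * T) *ᵥ u)) + (T *ᵥ u) ⬝ᵥ (C *ᵥ (T *ᵥ u)) := by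
    rw [Matrix.add_mulVec, Matrix.add_mulVec, dotProduct_add, dotProduct_add, Matrix.smul_mulVec,
      dotProduct_smul, smul_eq_mul, h']
  rw [e]
  nlinarith

/-! ### Lemma 7.3, scalar form -/

/-- **Hamilton 1986, Lemma 7.3 (scalar form).** With `x = a₁ > 0`, `a₂`, `Mᴬ = a₃`, `k = b₁ ≥ 0`,
`μ = b₂ ≥ k`, `Y = b₂ + b₃ > 0`: if `x ≤ a₂ ≤ Mᴬ ≤ Hx` ((2)), `Y² ≤ GHx²` ((1) with `c₁ ≤ Ha₁`),
`0 < δ ≤ 1`, `8Hδ ≤ 1` and `4GHδ² ≤ 1`, then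
`2δ(Mᴬ - x) ≤ (x - k)²/x + 2Mᴬ(a₂ - x)/x + 2(μ/Y)(Mᴬ - a₂)`.
Proof as printed: if `k ≤ x/2` the first term is `≥ x/4 ≥ 2δHx ≥ 2δ(Mᴬ - x)`; if `k ≥ x/2` then
`μ ≥ x/2` and `2δY ≤ x`, so `μ/Y ≥ δ`, while `2Mᴬ(a₂ - x)/x ≥ 2(a₂ - x)`.
[cite: Hamilton1986, §7, Lemma 7.3 (p. 172)] -/
theorem lemma73 {x a MA k μ Y G H δ : ℝ} (hx : 0 < x) (hxa : x ≤ a) (haM : a ≤ MA)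
    (hMA : MA ≤ H * x) (hk : 0 ≤ k) (hkμ : k ≤ μ) (hY : 0 < Y) (hY2 : Y ^ 2 ≤ G * H * x ^ 2)
    (hδ : 0 < δ) (hδ1 : δ ≤ 1) (hδH : 8 * H * δ ≤ 1) (hδGH : 4 * G * H * δ ^ 2 ≤ 1) :
    2 * δ * (MA - x) ≤ (x - k) ^ 2 / x + 2 * MA * (a - x) / x + 2 * (μ / Y) * (MA - a) := by
  have hMA0 : 0 ≤ MA := by linarith
  have hμ0 : 0 ≤ μ := hk.trans hkμ
  have t1 : 0 ≤ (x - k) ^ 2 / x := div_nonneg (sq_nonneg _) hx.le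
  have t2 : 0 ≤ 2 * MA * (a - x) / x := div_nonneg (by nlinarith) hx.le
  have t3 : 0 ≤ 2 * (μ / Y) * (MA - a) := by
    have := div_nonneg hμ0 hY.le
    nlinarith
  rcases le_or_gt k (x / 2) with hcase | hcase
  · -- Case 1: `k ≤ x/2`
    have h1 : x / 4 ≤ (x - k) ^ 2 / x := by
      rw [le_div_iff₀ hx]
      nlinarith
    have h2 : 2 * δ * (MA - x) ≤ x / 4 := by nlinarith
    linarith
  · -- Case 2: `k > x/2`
    have hμx : x / 2 ≤ μ := by linarith
    have hsq : (2 * δ * Y) ^ 2 ≤ x ^ 2 := by nlinarith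
    have hδY : 2 * δ * Y ≤ x := (abs_le_of_sq_le_sq' hsq hx.le).2
    have hδμY : δ ≤ μ / Y := by
      rw [le_div_iff₀ hY]
      linarith
    have h3 : 2 * (a - x) ≤ 2 * MA * (a - x) / x := by
      rw [le_div_iff₀ hx]
      nlinarith
    have h4 : 2 * δ * (MA - a) ≤ 2 * (μ / Y) * (MA - a) := by nlinarith
    nlinarith

end HamiltonODE

end Literature.Geometry.Riemannian

end
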